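import Summits.QuantumFields.YangMills.Theorems.AlphaInputsT3ACv3LinearLiftSmooth
import Summits.QuantumFields.YangMills.Theorems.AlphaInputsT3ACv3LinearLiftMatrix
import HarnessLib

/-!
# `AlphaInputsT3ACv3LinearLiftSmoothLin` — (LL+) companion: the sup-small exact lift `liftS` is `ℝ`-LINEAR (`liftSL : Ω¹(T^{(k)}) →ₗ[ℝ] Ω¹(T^{(0)})`, ready for the entrywise
# matrix port `byEntry` of `…LinearLiftMatrix`), it IS the spread of the gauge-corrected coarse form (`liftS k A = S1 k (A + dΨ_k(S1 k A))`), and the INTERPOLATION LETTERS of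
# `S0` (`S0 1 = 1`, local sup bound, interpolation error `|S0 Φ (x) − Φ y₀| ≤ 18^d · max_{y near x}|Φ y − Φ y₀|`) — cell `ym3-torus`, width seat `ym-ust-19936-w2` (g2)

WHY (this seat's PROGRESS 1, 2026-08-28; w3-19936 (V) `byEntry`∕`liftM`; w1-19936 Newton v2; alpha-2 g5 01:04:57Z (3d) «linear step = S¹∕S⁰ in local log frames»).  (i) The matrix
port needs `liftS` as a LINEAR map (kernel rows, `norm_byEntry_le_of_bound`); (ii) a covariant (frame-transported) version of the lift only needs a covariant `S1`, because the smooth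
coboundary correction is coarse data: `liftS k A = S1 k (A + dΨ_k(S1 k A))`; (iii) blockwise-gauge schemes compare a block-constant frame change `λ` with its smooth interpolant
`S0 λ`: the error is controlled by the OSCILLATION of `λ` over the `3^d` neighbouring cells (`abs_S0_sub_le_local`), since `S0` reproduces constants (`S0_one`, partition of unity
`Psig_pou`) and reads only the cells near `x` (`S0_weight_eq_zero_of_not_near`).
WHAT.  §1 `S0_add`, `S0_smul`, `S0_sub`, `liftS_add`, `liftS_smul`, `liftS_sub`, `S0L`, `liftSL` (+ `_apply`), ★ `liftS_eq_S1`; §2 `S0_weight_eq_zero_of_not_near`, `S0_one`, `S0_const`,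
★ `abs_S0_le_local`, ★★ `abs_S0_sub_le_local`, `abs_dgrad_S0_le_local`.
HONEST FRAMING.  Finite-dimensional lattice linear algebra over `…LinearLiftSmooth` (p592127) and `…LinearLiftMatrix` (p591442); count-neutral helper toward the (FL) row of 2′∕2′χ
(`--supports stmt-QuantumFields-19936`); (FL)∕`hLift` is NOT proved here; registry untouched.  YM₃ on the three-torus is RUNG R3 of the programme, not the Clay problem; no claim
about d = 4, infinite volume or a mass gap.

References: T. Bałaban, Commun. Math. Phys. 109 (1987) 249–301 [Balaban1987RG1] ((0.1) p.251, (0.4)+(0.11) p.253).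
-/

set_option autoImplicit false

noncomputable section

namespace Summit.QuantumFields.YangMills.Theorems.LinearLiftSpread

open Finset
open Literature.MathematicalPhysics.QuantumFieldTheory.Balaban1983to89
open Summit.QuantumFields.YangMills.Theorems.LinearLiftGauge (dgrad dgrad_add dgrad_sub psiIter)
open Summit.QuantumFields.YangMills.Theorems.LinearLiftProfile
open Summit.QuantumFields.YangMills.Theorems.LinearLiftMatrix (S1_add S1_smul psiIter_add psiIter_smul dgrad_smul)

variable {P : Params}

/-! ## §1 Linearity of `S0` and of the smooth lift; the smooth lift as a pure spread -/

/-- The spread of a 0-form is additive. [folklore] -/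
theorem S0_add (k : ℕ) (Φ Φ' : Site P k → ℝ) : S0 k (Φ + Φ') = S0 k Φ + S0 k Φ' := by
  funext x
  simp only [S0, Pi.add_apply, add_mul, sum_add_distrib]

/-- The spread of a 0-form is homogeneous. [folklore] -/
theorem S0_smul (k : ℕ) (r : ℝ) (Φ : Site P k → ℝ) : S0 k (r • Φ) = r • S0 k Φ := by
  funext x
  simp only [S0, Pi.smul_apply, smul_eq_mul, mul_sum]
  refine sum_congr rfl fun y _ => ?_
  ring

/-- The spread of a 0-form: subtraction. [folklore] -/
theorem S0_sub (k : ℕ) (Φ Φ' : Site P k → ℝ) : S0 k (Φ - Φ') = S0 k Φ - S0 k Φ' := by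
  rw [sub_eq_add_neg, S0_add, ← neg_one_smul ℝ Φ', S0_smul, neg_one_smul, ← sub_eq_add_neg]

/-- **THE SPREAD OF A 0-FORM AS AN `ℝ`-LINEAR MAP**. [folklore] -/
def S0L (P : Params) (k : ℕ) : (Site P k → ℝ) →ₗ[ℝ] (Site P 0 → ℝ) where
  toFun := S0 k
  map_add' := S0_add k
  map_smul' := S0_smul k

/-- `S0L` is `S0`. [folklore] -/
@[simp] theorem S0L_apply (k : ℕ) (Φ : Site P k → ℝ) : S0L P k Φ = S0 k Φ := rfl

/-- **THE SMOOTH LIFT IS ADDITIVE**. [cite: Balaban1987RG1, (0.4)+(0.11) p.253] -/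
theorem liftS_add (k : ℕ) (A B : PBond P k → ℝ) : liftS k (A + B) = liftS k A + liftS k B := by
  unfold liftS
  rw [S1_add, psiIter_add, S0_add, dgrad_add]
  funext b
  simp only [Pi.add_apply]
  ring

/-- **THE SMOOTH LIFT IS HOMOGENEOUS**. [cite: Balaban1987RG1, (0.4)+(0.11) p.253] -/
theorem liftS_smul (k : ℕ) (r : ℝ) (A : PBond P k → ℝ) : liftS k (r • A) = r • liftS k A := by
  unfold liftS
  rw [S1_smul, psiIter_smul, S0_smul, dgrad_smul]
  funext b
  simp only [Pi.add_apply, Pi.smul_apply, smul_eq_mul]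
  ring

/-- The smooth lift: subtraction. [cite: Balaban1987RG1, (0.4)+(0.11) p.253] -/
theorem liftS_sub (k : ℕ) (A B : PBond P k → ℝ) : liftS k (A - B) = liftS k A - liftS k B := by
  rw [sub_eq_add_neg, liftS_add, ← neg_one_smul ℝ B, liftS_smul, neg_one_smul, ← sub_eq_add_neg]

/-- **THE SMOOTH LIFT AS AN `ℝ`-LINEAR MAP** `Ω¹(T^{(k)}) → Ω¹(T^{(0)})` (the shape the entrywise matrix port `byEntry` consumes). [cite: Balaban1987RG1, (0.4)+(0.11) p.253] -/
def liftSL (P : Params) (k : ℕ) : (PBond P k → ℝ) →ₗ[ℝ] (PBond P 0 → ℝ) where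
  toFun := liftS k
  map_add' := liftS_add k
  map_smul' := liftS_smul k

/-- `liftSL` is `liftS`. [cite: Balaban1987RG1, (0.4)+(0.11) p.253] -/
@[simp] theorem liftSL_apply (k : ℕ) (A : PBond P k → ℝ) : liftSL P k A = liftS k A := rfl

/-- **★ THE SMOOTH LIFT IS THE SPREAD OF THE GAUGE-CORRECTED COARSE FORM**: `liftS k A = S1 k (A + dΨ_k(S1 k A))` (`d ∘ S0 = S1 ∘ d`) — the coboundary correction is COARSE data
(`dΨ_k(S1 A) = A − linAvgIter k (S1 A)`, `dgrad_psiIter_S1_eq`), so a frame-transported version of the lift needs a transported `S1` only. [cite: Balaban1987RG1, (0.4)+(0.11) p.253] -/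
theorem liftS_eq_S1 (k : ℕ) (hk : k ≤ P.m + P.K) (A : PBond P k → ℝ) : liftS k A = S1 k (A + dgrad (psiIter k (S1 k A))) := by
  unfold liftS
  rw [S1_add, ← dgrad_S0 k hk]

/-! ## §2 The interpolation letters of `S0` -/

section Interp

variable (k : ℕ) (hk : k ≤ P.m + P.K)

/-- Off the `3^d`-cell neighbourhood the `S⁰`-weight vanishes (one coordinate profile is `0` by `PS_eq_zero_of_far`). [folklore] -/
theorem S0_weight_eq_zero_of_not_near (x : Site P 0) (y : Site P k) (hy : ¬ Near k x y) : ∏ i, Psig (hh P k) (x i) (y i) = 0 := by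
  unfold Near at hy
  push Not at hy
  obtain ⟨i, hi⟩ := hy
  have hfar : ∀ r ∈ trip, y i ≠ (((qIdx (hh P k) (x i) : ℤ) - r : ℤ) : ZMod (P.sitesPerDir k)) := fun r hr h => hi r hr h
  exact prod_eq_zero (mem_univ i) (PS_eq_zero_of_far (hh P k) (sigma (hh P k)) _ _ (y i) hfar)

/-- **`S0` REPRODUCES CONSTANTS**: `S0 k 1 (x) = Π_i Σ_c Pσ(x_i, c) = 1` (the partition of unity `Psig_pou` in every coordinate). [cite: Balaban1987RG1, (0.1) p.251] -/
theorem S0_one (x : Site P 0) : S0 k (fun _ => (1 : ℝ)) x = 1 := by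
  have h : ∏ i : Fin P.d, ∑ c : ZMod (P.sitesPerDir k), Psig (hh P k) (x i) c = 1 :=
    prod_eq_one fun i _ => Psig_pou (hh P k) (x i)
  rw [Finset.prod_univ_sum] at h
  unfold S0
  simp_rw [one_mul]
  exact h

/-- `S0 k (const c) = c`. [cite: Balaban1987RG1, (0.1) p.251] -/
theorem S0_const (c : ℝ) (x : Site P 0) : S0 k (fun _ => c) x = c := by
  have h := S0_smul k c (fun _ : Site P k => (1 : ℝ))
  have e : (c • fun _ : Site P k => (1 : ℝ)) = fun _ => c := by funext y; simp
  rw [e] at h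
  rw [h, Pi.smul_apply, S0_one k x, smul_eq_mul, mul_one]

include hk

/-- **★ THE LOCAL SUP BOUND OF THE SPREAD OF A 0-FORM**: `|S0 k Φ (x)| ≤ 18^d·M` as soon as `|Φ y| ≤ M` for the coarse sites `y` NEAR `x` only. [cite: Balaban1987RG1, (0.1) p.251] -/
theorem abs_S0_le_local (Φ : Site P k → ℝ) (x : Site P 0) {M : ℝ} (hΦ : ∀ y : Site P k, Near k x y → |Φ y| ≤ M) :
    |S0 k Φ x| ≤ (18 : ℝ) ^ P.d * M := by
  classical
  let Φ' : Site P k → ℝ := fun y => if Near k x y then Φ y else 0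
  have hS : S0 k Φ x = S0 k Φ' x := by
    unfold S0
    refine sum_congr rfl fun y _ => ?_
    by_cases hy : Near k x y
    · simp only [Φ', if_pos hy]
    · simp only [Φ', if_neg hy]
      rw [S0_weight_eq_zero_of_not_near k x y hy]; ring
  rw [hS]
  have hM : 0 ≤ M := (abs_nonneg _).trans (hΦ _ (near_self k hk x))
  refine LinearAvgSup.abs_S0_le k Φ' (fun y => ?_) x
  by_cases hy : Near k x y
  · simp only [Φ', if_pos hy]; exact hΦ y hy
  · simp only [Φ', if_neg hy, abs_zero]; exact hM

/-- **★★ THE INTERPOLATION ERROR OF `S0` IS AN OSCILLATION**: `|S0 k Φ (x) − Φ y₀| ≤ 18^d · η` as soon as `|Φ y − Φ y₀| ≤ η` for the coarse sites `y` NEAR `x` — the letter that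
compares a block-constant frame change with its smooth interpolant. [cite: Balaban1987RG1, (0.1) p.251] -/
theorem abs_S0_sub_le_local (Φ : Site P k → ℝ) (x : Site P 0) (y₀ : Site P k) {η : ℝ} (hΦ : ∀ y : Site P k, Near k x y → |Φ y - Φ y₀| ≤ η) :
    |S0 k Φ x - Φ y₀| ≤ (18 : ℝ) ^ P.d * η := by
  have e : S0 k Φ x - Φ y₀ = S0 k (Φ - fun _ => Φ y₀) x := by
    rw [S0_sub, Pi.sub_apply, S0_const k (Φ y₀) x]
  rw [e]
  exact abs_S0_le_local k hk (Φ - fun _ => Φ y₀) x fun y hy => by simpa only [Pi.sub_apply] using hΦ y hy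

/-- **THE LOCAL BOUND OF THE SMOOTH COBOUNDARY GAUGE**: `|d(S0 Φ)(b)| ≤ 18^d·M/L^k` as soon as `|dΦ(y, μ_b)| ≤ M` for the coarse sites `y` NEAR `b₋`. [cite: Balaban1987RG1, (0.4) p.253] -/
theorem abs_dgrad_S0_le_local (Φ : Site P k → ℝ) (b : PBond P 0) {M : ℝ} (hΦ : ∀ y : Site P k, Near k b.src y → |dgrad Φ ⟨y, b.dir⟩| ≤ M) :
    |dgrad (S0 k Φ) b| ≤ (18 : ℝ) ^ P.d * M / (P.L : ℝ) ^ k := by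
  rw [dgrad_S0 k hk Φ]
  exact abs_S1_le_local k hk (dgrad Φ) b hΦ

end Interp

end Summit.QuantumFields.YangMills.Theorems.LinearLiftSpread

end
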